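import Literature.NumberTheory.GaloisRepresentations.BlochKatoSelmerGroup
import Literature.NumberTheory.GaloisRepresentations.PAdicHodge
import Literature.NumberTheory.GaloisRepresentations.ContinuousH1
import HarnessLib

/-!
# Bloch–Kato's finite part `H¹_f(K, V) = ker (H¹(K, V) → H¹(K, B_crys ⊗ V))` at `v ∣ p`

Let `K` be a finite extension of `ℚ_p` and `V` a finite-dimensional `ℚ_p`-vector space with a
continuous linear action of `Γ_K = Gal(K̄/K)`.  Bloch and Kato define
`H¹_f(K, V) := Ker (H¹(K, V) → H¹(K, B_crys ⊗_{ℚ_p} V))` [BlochKato1990, (3.7.2)] and, for a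
`Γ_K`-stable `ℤ_p`-lattice `T`, `H¹_f(K, T) := ι⁻¹ H¹_f(K, T ⊗ ℚ)` along `ι : H¹(K, T) → H¹(K, T ⊗ ℚ)`
[BlochKato1990, (3.7.3)]; for the divisible module `W = V/T` one puts
`H¹_f(K, W) := im (H¹_f(K, V) → H¹(K, W))` [DiamondFlachGuo2004, §2.1], which is the tree's
`BlochKatoDatum.imageSubgroup` / `BlochKatoDatum.LocalConditionsAbove.ofDatum`
(file `BlochKatoSelmerGroup`, where the condition above `p` was left a PARAMETER
`BlochKatoDatum.LocalConditionsAbove`).  This file constructs that parameter.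

## The point of the construction: the kernel is topology-free in `B`

The tree's period rings (`PeriodRingData`, file `PAdicHodge`) carry no topology, so the continuous
cohomology group `H¹(K, B_crys ⊗ V)` cannot be formed.  It is not needed: in continuous cohomology
computed with continuous cochains (Mathlib's `continuousCohomology`, made explicit in degree one in
file `ContinuousH1`: every class is the class `oneCocycleClass φ` of a continuous crossed
homomorphism `φ : Γ → V`, and `[φ] = 0 ↔ φ g = g • v - v` for some `v`,
`oneCocycleClass_eq_zero_iff`), the image of `[φ]` in `H¹(K, N)` along an equivariant map
`ι : V → N` vanishes iff `ι ∘ φ` is a coboundary `g ↦ g • n - n` of `N` — a condition on the bare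
`Γ`-module `N` in which no topology on `N` enters (a coboundary is continuous as soon as `φ` is).
Hence, for ANY topology on `N = B_crys ⊗ V` making it a topological `Γ_K`-module with `ι` continuous,
`Ker (H¹(K, V) → H¹(K, B_crys ⊗ V)) = {[φ] | ∃ b ∈ B_crys ⊗ V, ∀ g, 1 ⊗ φ g = g • b - b}`;
this is proved here as `ContinuousRep.cohomologyKer_eq_ker_cohomologyMap`, and the right-hand side
is taken as the definition (`ContinuousRep.cohomologyKer`, `ContinuousRep.blochKatoSubgroup`).

## Main definitions

* `ContinuousRep.kerCocycles τ σ ι ≤ contOneCocycles`, `ContinuousRep.cohomologyKer τ σ ι ≤ H¹(G, V)`: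
  for a continuous `ℤ`-linear representation `τ` of a topological group `G` on `V`, an abstract
  representation `σ` of `G` on `N` and an additive map `ι : V → N`, the continuous 1-cocycles
  (resp. classes) that become coboundaries in `N` — "`Ker (H¹(G, V) → H¹(G, N))`".
* `ContinuousRep.IsLinear P τ`: the operators of the `ℤ`-linear `τ` are `P`-linear
  (`BlochKatoDatum.repV` is recorded `ℤ`-linearly; Fontaine's formalism needs the `ℚ_p`-structure);
  `ContinuousRep.linearize τ h : ContinuousRep G P V`.
* `ContinuousRep.blochKatoSubgroup 𝔅 τ h ≤ H¹(G, V)`: **`Ker (H¹(G, V) → H¹(G, B ⊗_P V))`** for a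
  period-ring datum `𝔅 : PeriodRingData G P E` (diagonal action `PeriodRingData.tensorRep`,
  `ι v = 1 ⊗ v`).  With `𝔅 = B_crys` this is `H¹_f(K, V)` [BlochKato1990, (3.7.2)]; with `B_dR` it is
  `H¹_g(K, V)`.
* `ContinuousRep.latticeBlochKatoSubgroup`: `H¹_f(K, T) = ι⁻¹ H¹_f(K, V)` for an equivariant
  continuous `ι : T → V` [BlochKato1990, (3.7.3)].
* `BlochKatoDatum.crystallineSubgroup D 𝔅 h ≤ H¹(F, V)` and its image
  `BlochKatoDatum.crystallineImageSubgroup D 𝔅 h = H¹_f(F, W) ≤ H¹(F, W)` for a Bloch–Kato datum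
  `π : V → W` over a field `F` [DiamondFlachGuo2004, §2.1].
* **`BlochKatoDatum.crystallineConditionsAbove D 𝔅 h : D.LocalConditionsAbove p`** over a number
  field `K`: at each `v ∣ p`, `H¹_f(K_v, V)` relative to a crystalline period-ring datum `𝔅 v hv` of
  `K_v` (supplied, as in `GaloisRep.IsGeometric`, together with the missing
  `Algebra ℚ_[p] (v.adicCompletion K)` structure); `crystallineConditionsAboveW` is its transport
  `π_*` to `W`, and `blochKatoSelmerGroup p D (D.crystallineConditionsAbove 𝔅 h)` is then literally
  Bloch–Kato's `H¹_f(K, W)` [BlochKato1990, Def. 5.1].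

## Main results (all proved)

* `ContinuousRep.oneCocycleClass_mem_cohomologyKer_iff`: membership does not depend on the
  representing cocycle (for equivariant `ι`).
* `ContinuousRep.cohomologyKer_eq_ker_cohomologyMap`: if `N` carries a topology making it a
  topological `G`-module `τ'` with `ι` continuous, `cohomologyKer τ τ' ι = ker (ι_* : H¹(G,V) → H¹(G,N))`.
* `ContinuousRep.cohomologyKer_mono` (functoriality in `N`), `cohomologyKer_id = ⊥`,
  `cohomologyKer_zero = ⊤`; `ContinuousRep.blochKatoSubgroup_mono`: an equivariant `P`-algebra map
  `B → B'` (e.g. `B_crys → B_dR`) gives `Ker (→ B ⊗ V) ≤ Ker (→ B' ⊗ V)`, i.e. `H¹_f ≤ H¹_g`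
  [BlochKato1990, (3.7)].

## Design notes

* Everything is relative to a supplied period-ring datum, exactly as `GaloisRep.IsCrystalline`;
  instantiating `𝔅` with Fontaine's `B_cris` (once constructed) gives the genuine `H¹_f`.
* The extension description (a class `a ∈ H¹(K, V)` is in `H¹_f` iff the extension
  `0 → V → E_a → ℚ_p → 0` is crystalline, valid when `V` is crystalline [BlochKato1990, remark after
  (3.7.4), p. 354]) is not used as the definition: it is only correct for crystalline `V`, whereas
  (3.7.2) is unconditional.
* No `ℚ_p`-structure is put on `H¹`; the subgroups are `AddSubgroup`s, as in `BlochKatoSelmerGroup`.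

## References

* [BlochKato1990] S. Bloch, K. Kato, *L-functions and Tamagawa numbers of motives*, The Grothendieck
  Festschrift I (1990), §3: (3.7), (3.7.1)–(3.7.3) (p. 353–354), remark after (3.7.4), Def. 5.1.
* [DiamondFlachGuo2004] F. Diamond, M. Flach, L. Guo, *The Tamagawa number conjecture of adjoint
  motives of modular forms*, Ann. Sci. ÉNS 37 (2004), §2.1 (p. 695).
* [Rubin2000] K. Rubin, *Euler Systems* (2000), §1.3 (Def. 1.3.4).
* J.-M. Fontaine, Astérisque 223 (1994), Exposé III §1 (the formalism of `B ⊗ V`, tree `PAdicHodge`).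
-/

noncomputable section

open scoped NumberField TensorProduct
open Field IsDedekindDomain CategoryTheory NumberField TensorProduct

namespace Literature.NumberTheory.GaloisRepresentations

universe u v v' w

namespace ContinuousRep

/-! ### Classes of `H¹(G, V)` that die in an abstract `G`-module `N` -/

section Ker

variable {G : Type u} [Group G] [TopologicalSpace G] [IsTopologicalGroup G]
  {V : Type u} [AddCommGroup V] [TopologicalSpace V] [IsTopologicalAddGroup V]
  {R : Type*} [Semiring R] {N : Type*} [AddCommGroup N] [Module R N]
  {R' : Type*} [Semiring R'] {N' : Type*} [AddCommGroup N'] [Module R' N']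

/-- The continuous crossed homomorphisms `φ : G → V` of `τ` which **become coboundaries in `N`**
along the additive map `ι : V → N`: `ι (φ g) = σ g n - n` for some `n ∈ N` and all `g`.  Here `σ`
is an abstract (not topologised) linear action of `G` on `N`; intended: `N = B ⊗_{ℚ_p} V`,
`ι v = 1 ⊗ v`.  An additive subgroup of `contOneCocycles τ.toTopRep`. [folklore] -/
def kerCocycles (τ : ContinuousRep G ℤ V) (σ : Representation R G N) (ι : V →+ N) :
    AddSubgroup (contOneCocycles τ.toTopRep) where
  carrier := {φ | ∃ n : N, ∀ g : G, ι (φ.1 g) = σ g n - n}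
  zero_mem' := ⟨0, fun g => by simp⟩
  add_mem' := by
    rintro φ ψ ⟨n, hn⟩ ⟨m, hm⟩
    refine ⟨n + m, fun g => ?_⟩
    change ι (φ.1 g + ψ.1 g) = _
    rw [map_add, hn g, hm g, map_add]
    abel
  neg_mem' := by
    rintro φ ⟨n, hn⟩
    refine ⟨-n, fun g => ?_⟩
    change ι (-(φ.1 g)) = _
    rw [map_neg, hn g, map_neg]
    abel

omit [IsTopologicalGroup G] in
/-- Membership in `kerCocycles`. [folklore] -/
theorem mem_kerCocycles_iff (τ : ContinuousRep G ℤ V) (σ : Representation R G N) (ι : V →+ N)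
    (φ : contOneCocycles τ.toTopRep) :
    φ ∈ τ.kerCocycles σ ι ↔ ∃ n : N, ∀ g : G, ι (φ.1 g) = σ g n - n :=
  Iff.rfl

/-- **`Ker (H¹(G, V) → H¹(G, N))`, topology-free in `N`**: the classes in `H¹_cont(G, V)`
(`ContinuousRep.cohomology τ 1`, Mathlib's `continuousCohomology`) represented by a continuous
crossed homomorphism that becomes a coboundary in the abstract `G`-module `N` along `ι : V → N`
(the image of `kerCocycles` under the class map `oneCocycleClassₗ`).  For every topology on `N`
making it a topological `G`-module with `ι` continuous this IS the kernel of
`ι_* : H¹(G, V) → H¹(G, N)` (`cohomologyKer_eq_ker_cohomologyMap`). [folklore] -/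
def cohomologyKer (τ : ContinuousRep G ℤ V) (σ : Representation R G N) (ι : V →+ N) :
    AddSubgroup (τ.cohomology 1) :=
  (τ.kerCocycles σ ι).map
    ((oneCocycleClassₗ τ.toTopRep).toAddMonoidHom : contOneCocycles τ.toTopRep →+ τ.cohomology 1)

/-- Membership in `cohomologyKer`: some representing cocycle becomes a coboundary in `N`. [folklore] -/
theorem mem_cohomologyKer_iff (τ : ContinuousRep G ℤ V) (σ : Representation R G N) (ι : V →+ N)
    (x : τ.cohomology 1) :
    x ∈ τ.cohomologyKer σ ι ↔ ∃ φ : contOneCocycles τ.toTopRep,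
      (∃ n : N, ∀ g : G, ι (φ.1 g) = σ g n - n) ∧ oneCocycleClass τ.toTopRep φ = x := by
  constructor
  · rintro ⟨φ, hφ, rfl⟩
    exact ⟨φ, hφ, rfl⟩
  · rintro ⟨φ, hφ, rfl⟩
    exact ⟨φ, hφ, rfl⟩

/-- The class of a cocycle that becomes a coboundary in `N` lies in `cohomologyKer`. [folklore] -/
theorem oneCocycleClass_mem_cohomologyKer (τ : ContinuousRep G ℤ V) (σ : Representation R G N)
    (ι : V →+ N) {φ : contOneCocycles τ.toTopRep} {n : N} (h : ∀ g : G, ι (φ.1 g) = σ g n - n) :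
    oneCocycleClass τ.toTopRep φ ∈ τ.cohomologyKer σ ι :=
  (τ.mem_cohomologyKer_iff σ ι _).2 ⟨φ, ⟨n, h⟩, rfl⟩

/-- **Independence of the representative.**  If `ι` is `G`-equivariant, the class of `φ` lies in
`cohomologyKer` iff `φ` itself becomes a coboundary in `N` (two representatives differ by a
principal crossed homomorphism `g ↦ g • v - v`, `oneCocycleClass_eq_zero_iff`, whose image under
`ι` is the coboundary of `ι v`).  Serre, *Galois Cohomology*, I.§5.1. [folklore] -/
theorem oneCocycleClass_mem_cohomologyKer_iff (τ : ContinuousRep G ℤ V) (σ : Representation R G N)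
    (ι : V →+ N) (hι : ∀ (g : G) (x : V), ι (τ g x) = σ g (ι x))
    (φ : contOneCocycles τ.toTopRep) :
    oneCocycleClass τ.toTopRep φ ∈ τ.cohomologyKer σ ι ↔ ∃ n : N, ∀ g : G, ι (φ.1 g) = σ g n - n := by
  refine ⟨fun h => ?_, fun ⟨n, hn⟩ => τ.oneCocycleClass_mem_cohomologyKer σ ι hn⟩
  obtain ⟨ψ, ⟨n, hn⟩, hψ⟩ := (τ.mem_cohomologyKer_iff σ ι _).1 h
  have h0 : oneCocycleClass τ.toTopRep (φ - ψ) = 0 := by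
    rw [oneCocycleClass_sub, hψ, sub_self]
  obtain ⟨v, hv⟩ := (oneCocycleClass_eq_zero_iff τ.toTopRep (φ - ψ)).1 h0
  refine ⟨n + ι v, fun g => ?_⟩
  have h1 : φ.1 g = ψ.1 g + (τ g v - v) := by
    have := hv g
    change φ.1 g - ψ.1 g = τ g v - v at this
    rw [← this, add_sub_cancel]
  rw [h1, map_add, map_sub, hn g, hι, map_add]
  abel

/-- **Functoriality in the target.**  An additive map `f : N → N'` intertwining `σ` and `σ'` with
`f ∘ ι = ι'` carries coboundaries to coboundaries: `Ker (→ N) ≤ Ker (→ N')`.  (For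
`B_crys^{φ=1} ⊆ B_crys ⊆ B_dR` these are the inclusions `H¹_e ⊆ H¹_f ⊆ H¹_g`.)
[cite: BlochKato1990, (3.7)] -/
theorem cohomologyKer_mono (τ : ContinuousRep G ℤ V) (σ : Representation R G N) (ι : V →+ N)
    (σ' : Representation R' G N') (ι' : V →+ N') (f : N →+ N')
    (hf : ∀ (g : G) (n : N), f (σ g n) = σ' g (f n)) (hfι : ∀ x : V, f (ι x) = ι' x) :
    τ.cohomologyKer σ ι ≤ τ.cohomologyKer σ' ι' := by
  intro x hx
  obtain ⟨φ, ⟨n, hn⟩, rfl⟩ := (τ.mem_cohomologyKer_iff σ ι x).1 hx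
  refine τ.oneCocycleClass_mem_cohomologyKer σ' ι' (n := f n) fun g => ?_
  rw [← hfι, hn g, map_sub, hf]

/-- Along the identity `V → V` only the zero class dies: `cohomologyKer τ τ id = ⊥`
(`oneCocycleClass_eq_zero_iff`). [folklore] -/
theorem cohomologyKer_id (τ : ContinuousRep G ℤ V) :
    τ.cohomologyKer τ.toRepresentation (AddMonoidHom.id V) = ⊥ := by
  refine (AddSubgroup.eq_bot_iff_forall _).2 fun x hx => ?_
  obtain ⟨φ, ⟨n, hn⟩, rfl⟩ := (τ.mem_cohomologyKer_iff _ _ x).1 hx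
  exact (oneCocycleClass_eq_zero_iff τ.toTopRep φ).2 ⟨n, hn⟩

/-- Along the zero map every class dies: `cohomologyKer τ σ 0 = ⊤`. [folklore] -/
theorem cohomologyKer_zero (τ : ContinuousRep G ℤ V) (σ : Representation R G N) :
    τ.cohomologyKer σ (0 : V →+ N) = ⊤ := by
  refine (AddSubgroup.eq_top_iff' _).2 fun x => ?_
  obtain ⟨φ, rfl⟩ := oneCocycleClass_surjective τ.toTopRep x
  exact τ.oneCocycleClass_mem_cohomologyKer σ 0 (n := 0) fun g => by simp

end Ker

/-! ### Comparison with the kernel of `ι_*` when `N` is topologised -/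

section KerTop

variable {G : Type u} [Group G] [TopologicalSpace G] [IsTopologicalGroup G]
  {V : Type u} [AddCommGroup V] [TopologicalSpace V] [IsTopologicalAddGroup V]
  {N : Type u} [AddCommGroup N] [TopologicalSpace N] [IsTopologicalAddGroup N]

/-- **`cohomologyKer` is the kernel of `ι_*`.**  If the target `N` is a topological `G`-module
`τ'` and `ι : V → N` is continuous and equivariant, then the topology-free subgroup
`cohomologyKer τ τ' ι` is exactly `ker (ι_* : H¹_cont(G, V) → H¹_cont(G, N))`
(`ContinuousRep.cohomologyMap`; by `map_oneCocycleClass` and `oneCocycleClass_eq_zero_iff`).  In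
particular Bloch–Kato's `Ker (H¹(K, V) → H¹(K, B_crys ⊗ V))` does not depend on the topology of
`B_crys ⊗ V`.  Serre, *Galois Cohomology*, I.§2.2, I.§5.1. [folklore] -/
theorem cohomologyKer_eq_ker_cohomologyMap (τ : ContinuousRep G ℤ V) (τ' : ContinuousRep G ℤ N)
    (ι : V →+ N) (hι : Continuous ι) (h : ∀ (g : G) (x : V), ι (τ g x) = τ' g (ι x)) :
    τ.cohomologyKer τ'.toRepresentation ι = (τ.cohomologyMap τ' ι hι h 1).ker := by
  ext x
  obtain ⟨φ, rfl⟩ := oneCocycleClass_surjective τ.toTopRep x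
  have key : ContinuousCohomology.map (ContinuousMonoidHom.id G) (X := τ.toTopRep) (Y := τ'.toTopRep)
      (TopRep.ofHom ⟨⟨ι.toIntLinearMap, hι⟩, fun g => ContinuousLinearMap.ext fun x => h g x⟩) 1
        (oneCocycleClass τ.toTopRep φ) = 0 ↔ ∃ n : N, ∀ g : G, ι (φ.1 g) = τ' g n - n := by
    rw [map_oneCocycleClass, oneCocycleClass_eq_zero_iff]
    rfl
  have key' : τ.cohomologyMap τ' ι hι h 1 (oneCocycleClass τ.toTopRep φ) = 0 ↔
      ∃ n : N, ∀ g : G, ι (φ.1 g) = τ' g n - n := key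
  exact (τ.oneCocycleClass_mem_cohomologyKer_iff τ'.toRepresentation ι h φ).trans
    (key'.symm.trans (AddMonoidHom.mem_ker (f := τ.cohomologyMap τ' ι hι h 1)).symm)

end KerTop

/-! ### `ℚ_p`-linearity of a `ℤ`-linearly recorded representation -/

section Linear

variable {G : Type u} [Group G] [TopologicalSpace G]
  (P : Type v) [CommRing P] {V : Type w} [AddCommGroup V] [Module P V] [TopologicalSpace V]

/-- The operators of the continuous `ℤ`-linear representation `τ` are `P`-linear for the given
`P`-module structure on `V` (e.g. `BlochKatoDatum.repV`, recorded `ℤ`-linearly, of a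
`ℚ_p`-representation).  A predicate on `τ`. [folklore] -/
def IsLinear (τ : ContinuousRep G ℤ V) : Prop :=
  ∀ (g : G) (c : P) (x : V), τ g (c • x) = c • τ g x

variable {P}

/-- `P`-linearity is preserved by restriction along a continuous homomorphism. [folklore] -/
theorem IsLinear.restrict {H : Type*} [Group H] [TopologicalSpace H] {τ : ContinuousRep G ℤ V}
    (h : τ.IsLinear P) (φ : H →ₜ* G) : (τ.restrict φ).IsLinear P :=
  fun g c x => h (φ g) c x

variable [TopologicalSpace P]

/-- `toIntRep` of a `P`-linear representation is `P`-linear. [folklore] -/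
theorem isLinear_toIntRep (ρ : ContinuousRep G P V) : ρ.toIntRep.IsLinear P :=
  fun g c x => (ρ g).map_smul c x

/-- Upgrade a continuous `ℤ`-linear representation with `P`-linear operators to a continuous
`P`-linear representation on the same topological module (same operators, same continuity).
[folklore] -/
def linearize (τ : ContinuousRep G ℤ V) (h : τ.IsLinear P) : ContinuousRep G P V where
  toRepresentation :=
    { toFun := fun g =>
        { toFun := τ g
          map_add' := map_add (τ g)
          map_smul' := h g }
      map_one' := by ext; simp
      map_mul' := fun _ _ => by ext; simp }
  continuous_smul := τ.continuous_smul

/-- `linearize` does not change the operators. [folklore] -/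
@[simp] theorem linearize_apply_apply (τ : ContinuousRep G ℤ V) (h : τ.IsLinear P) (g : G) (x : V) :
    τ.linearize h g x = τ g x := rfl

/-- `linearize` followed by `toIntRep` is the identity. [folklore] -/
theorem toIntRep_linearize (τ : ContinuousRep G ℤ V) (h : τ.IsLinear P) :
    (τ.linearize h).toIntRep = τ :=
  ContinuousRep.ext fun _ => LinearMap.ext fun _ => rfl

end Linear

/-! ### `Ker (H¹(G, V) → H¹(G, B ⊗ V))` for a period-ring datum -/

section Period

variable {G : Type u} [Group G] [TopologicalSpace G] [IsTopologicalGroup G]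
  {P : Type v} [Field P] [TopologicalSpace P] {E : Type v'} [Field E] [Algebra P E]
  {V : Type u} [AddCommGroup V] [Module P V] [TopologicalSpace V] [IsTopologicalAddGroup V]

/-- **Bloch–Kato's `Ker (H¹(G, V) → H¹(G, B ⊗_{ℚ_p} V))`** for a period-ring datum `𝔅` (`B = 𝔅.B`
with the diagonal action `σ ↦ σ ⊗ τ(σ)`, `PeriodRingData.tensorRep`, along `v ↦ 1 ⊗ v`): the classes
of continuous crossed homomorphisms `φ : G → V` with `1 ⊗ φ g = σ • b - b` for some `b ∈ B ⊗ V`.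
With `𝔅 = B_crys` (a `CrystallinePeriodRingData`) this is the finite part **`H¹_f(K, V)`**, with
`B_dR` the geometric part `H¹_g(K, V)`; topology-free in `B` (module docstring,
`cohomologyKer_eq_ker_cohomologyMap`).  `h` records that `G` acts `ℚ_p`-linearly on `V`.
[cite: BlochKato1990, (3.7.2)] -/
def blochKatoSubgroup (𝔅 : PeriodRingData.{u, v, v', w} G P E) (τ : ContinuousRep G ℤ V)
    (h : τ.IsLinear P) : AddSubgroup (τ.cohomology 1) :=
  τ.cohomologyKer (𝔅.tensorRep (τ.linearize h)) (TensorProduct.mk P 𝔅.B V 1).toAddMonoidHom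

omit [IsTopologicalGroup G] [IsTopologicalAddGroup V] in
/-- `v ↦ 1 ⊗ v` is equivariant for the diagonal action (`σ • 1 = 1`). [folklore] -/
theorem tensorRep_one_tmul (𝔅 : PeriodRingData.{u, v, v', w} G P E) (τ : ContinuousRep G ℤ V)
    (h : τ.IsLinear P) (g : G) (x : V) :
    𝔅.tensorRep (τ.linearize h) g ((1 : 𝔅.B) ⊗ₜ[P] x) = (1 : 𝔅.B) ⊗ₜ[P] τ g x := by
  rw [PeriodRingData.tensorRep_apply_tmul, smul_one, linearize_apply_apply]

/-- Membership of a class `[φ]` in `blochKatoSubgroup`: **`φ` becomes a coboundary in `B ⊗ V`**,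
`1 ⊗ φ g = (σ ⊗ τ σ) b - b`, independently of the representative `φ`. [cite: BlochKato1990, (3.7.2)] -/
theorem oneCocycleClass_mem_blochKatoSubgroup_iff (𝔅 : PeriodRingData.{u, v, v', w} G P E)
    (τ : ContinuousRep G ℤ V) (h : τ.IsLinear P) (φ : contOneCocycles τ.toTopRep) :
    oneCocycleClass τ.toTopRep φ ∈ τ.blochKatoSubgroup 𝔅 h ↔
      ∃ b : 𝔅.B ⊗[P] V, ∀ g : G, (1 : 𝔅.B) ⊗ₜ[P] φ.1 g = 𝔅.tensorRep (τ.linearize h) g b - b :=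
  τ.oneCocycleClass_mem_cohomologyKer_iff _ _ (fun g x => (tensorRep_one_tmul 𝔅 τ h g x).symm) φ

/-- Membership in `blochKatoSubgroup` for a general class. [folklore] -/
theorem mem_blochKatoSubgroup_iff (𝔅 : PeriodRingData.{u, v, v', w} G P E)
    (τ : ContinuousRep G ℤ V) (h : τ.IsLinear P) (x : τ.cohomology 1) :
    x ∈ τ.blochKatoSubgroup 𝔅 h ↔ ∃ φ : contOneCocycles τ.toTopRep,
      (∃ b : 𝔅.B ⊗[P] V, ∀ g : G, (1 : 𝔅.B) ⊗ₜ[P] φ.1 g = 𝔅.tensorRep (τ.linearize h) g b - b) ∧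
        oneCocycleClass τ.toTopRep φ = x :=
  τ.mem_cohomologyKer_iff _ _ x

/-- **`H¹_f ≤ H¹_g`-type monotonicity**: a `G`-equivariant `P`-algebra map of period rings
`f : B → B'` (e.g. `B_crys → B_dR`) gives `Ker (H¹ → H¹(B ⊗ V)) ≤ Ker (H¹ → H¹(B' ⊗ V))`.
[cite: BlochKato1990, (3.7)] -/
theorem blochKatoSubgroup_mono {E' : Type v'} [Field E'] [Algebra P E']
    (𝔅 : PeriodRingData.{u, v, v', w} G P E) (𝔅' : PeriodRingData.{u, v, v', w} G P E')
    (f : 𝔅.B →ₐ[P] 𝔅'.B) (hf : ∀ (g : G) (b : 𝔅.B), f (g • b) = g • f b)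
    (τ : ContinuousRep G ℤ V) (h : τ.IsLinear P) :
    τ.blochKatoSubgroup 𝔅 h ≤ τ.blochKatoSubgroup 𝔅' h := by
  refine τ.cohomologyKer_mono _ _ _ _ (TensorProduct.map f.toLinearMap LinearMap.id).toAddMonoidHom
    (fun g b => ?_) (fun x => by simp)
  change TensorProduct.map f.toLinearMap LinearMap.id (𝔅.tensorRep (τ.linearize h) g b) =
    𝔅'.tensorRep (τ.linearize h) g (TensorProduct.map f.toLinearMap LinearMap.id b)
  induction b using TensorProduct.induction_on with
  | zero => simp
  | tmul b x => simp [PeriodRingData.tensorRep_apply_tmul, hf]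
  | add b c hb hc => simp only [map_add, hb, hc]

end Period

/-! ### Lattices: `H¹_f(K, T) = ι⁻¹ H¹_f(K, V)` -/

section Lattice

variable {G : Type u} [Group G] [TopologicalSpace G] [IsTopologicalGroup G]
  {P : Type v} [Field P] [TopologicalSpace P] {E : Type v'} [Field E] [Algebra P E]
  {T : Type u} [AddCommGroup T] [TopologicalSpace T] [IsTopologicalAddGroup T]
  {V : Type u} [AddCommGroup V] [Module P V] [TopologicalSpace V] [IsTopologicalAddGroup V]

/-- **`H¹_f(K, T) := ι⁻¹ H¹_f(K, T ⊗ ℚ)`** for a lattice: the preimage of `blochKatoSubgroup 𝔅 τV`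
under `ι_* : H¹(G, T) → H¹(G, V)` (`ContinuousRep.cohomologyMap`) for a continuous equivariant
additive map `ι : T → V` (intended: the inclusion of a `G`-stable `ℤ_p`-lattice, `V = T ⊗ ℚ_p`).
It contains the kernel of `ι_*`, in particular (for a lattice) the torsion of `H¹(G, T)`.
[cite: BlochKato1990, (3.7.3)] -/
def latticeBlochKatoSubgroup (𝔅 : PeriodRingData.{u, v, v', w} G P E) (τT : ContinuousRep G ℤ T)
    (τV : ContinuousRep G ℤ V) (h : τV.IsLinear P) (ι : T →+ V) (hι : Continuous ι)
    (hιG : ∀ (g : G) (t : T), ι (τT g t) = τV g (ι t)) : AddSubgroup (τT.cohomology 1) :=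
  (τV.blochKatoSubgroup 𝔅 h).comap (τT.cohomologyMap τV ι hι hιG 1)

/-- Membership in `H¹_f(K, T)`: the image in `H¹(K, V)` lies in `H¹_f(K, V)`. [cite: BlochKato1990, (3.7.3)] -/
theorem mem_latticeBlochKatoSubgroup_iff (𝔅 : PeriodRingData.{u, v, v', w} G P E)
    (τT : ContinuousRep G ℤ T) (τV : ContinuousRep G ℤ V) (h : τV.IsLinear P) (ι : T →+ V)
    (hι : Continuous ι) (hιG : ∀ (g : G) (t : T), ι (τT g t) = τV g (ι t)) (x : τT.cohomology 1) :
    x ∈ τT.latticeBlochKatoSubgroup 𝔅 τV h ι hι hιG ↔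
      τT.cohomologyMap τV ι hι hιG 1 x ∈ τV.blochKatoSubgroup 𝔅 h :=
  Iff.rfl

/-- `ker ι_* ≤ H¹_f(K, T)` ("`H¹_f(K, T)` always contains the torsion subgroup of `H¹(K, T)`").
[cite: BlochKato1990, (3.7.3)] -/
theorem ker_cohomologyMap_le_latticeBlochKatoSubgroup (𝔅 : PeriodRingData.{u, v, v', w} G P E)
    (τT : ContinuousRep G ℤ T) (τV : ContinuousRep G ℤ V) (h : τV.IsLinear P) (ι : T →+ V)
    (hι : Continuous ι) (hιG : ∀ (g : G) (t : T), ι (τT g t) = τV g (ι t)) :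
    (τT.cohomologyMap τV ι hι hιG 1).ker ≤ τT.latticeBlochKatoSubgroup 𝔅 τV h ι hι hιG := by
  intro x hx
  rw [mem_latticeBlochKatoSubgroup_iff, (AddMonoidHom.mem_ker).1 hx]
  exact zero_mem _

end Lattice

end ContinuousRep

/-! ### The crystalline condition for a Bloch–Kato datum `π : V → W` -/

namespace BlochKatoDatum

section AnyField

variable {F : Type u} [Field F] {V W : Type u} [AddCommGroup V] [TopologicalSpace V]
  [IsTopologicalAddGroup V] [AddCommGroup W] [TopologicalSpace W] [DiscreteTopology W]
  {P : Type v} [Field P] [TopologicalSpace P] {E : Type v'} [Field E] [Algebra P E] [Module P V]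

/-- **`H¹_f(F, V) ≤ H¹(F, V)`** for a Bloch–Kato datum over a field `F` (intended: `F = K_v`,
`v ∣ p`), relative to a period-ring datum `𝔅` for `Γ_F` (intended: `B_crys` of `F`):
`Ker (H¹(F, V) → H¹(F, B ⊗_{ℚ_p} V))` (`ContinuousRep.blochKatoSubgroup` of `D.repV`).
[cite: BlochKato1990, (3.7.2)] -/
def crystallineSubgroup (D : BlochKatoDatum F V W)
    (𝔅 : PeriodRingData.{u, v, v', w} (absoluteGaloisGroup F) P E) (h : D.repV.IsLinear P) :
    AddSubgroup (D.repV.cohomology 1) :=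
  D.repV.blochKatoSubgroup 𝔅 h

/-- **`H¹_f(F, W) := im (H¹_f(F, V) → H¹(F, W))`** at a place above `p`: the transport `π_*` of the
crystalline subgroup (`imageSubgroup`). [cite: DiamondFlachGuo2004, §2.1] -/
def crystallineImageSubgroup (D : BlochKatoDatum F V W)
    (𝔅 : PeriodRingData.{u, v, v', w} (absoluteGaloisGroup F) P E) (h : D.repV.IsLinear P) :
    AddSubgroup (galoisCohomology D.repW 1) :=
  D.imageSubgroup (D.crystallineSubgroup 𝔅 h)

/-- Membership in `H¹_f(F, W)`: the class is `π_*` of a class of `H¹_f(F, V)`. [folklore] -/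
lemma mem_crystallineImageSubgroup_iff (D : BlochKatoDatum F V W)
    (𝔅 : PeriodRingData.{u, v, v', w} (absoluteGaloisGroup F) P E) (h : D.repV.IsLinear P)
    (c : galoisCohomology D.repW 1) :
    c ∈ D.crystallineImageSubgroup 𝔅 h ↔ ∃ x ∈ D.crystallineSubgroup 𝔅 h, D.projMap 1 x = c :=
  AddSubgroup.mem_map

omit [TopologicalSpace P] in
/-- `P`-linearity of `repV` passes to the restricted datum. [folklore] -/
theorem isLinear_restrictField (D : BlochKatoDatum F V W) (h : D.repV.IsLinear P) (L : Type u)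
    [Field L] [Algebra F L] : (D.restrictField L).repV.IsLinear P :=
  h.restrict (absGaloisRestrict F L)

end AnyField

section NumberField

variable {K : Type u} [Field K] [NumberField K] {V W : Type u} [AddCommGroup V] [TopologicalSpace V]
  [IsTopologicalAddGroup V] [AddCommGroup W] [TopologicalSpace W] [DiscreteTopology W]
  {p : ℕ} [Fact p.Prime] [Module ℚ_[p] V]

/-- **The crystalline local conditions above `p`** of a Bloch–Kato datum `π : V → W` over a number
field `K` whose `V` is a `ℚ_p`-representation (`h`): at each finite place `v ∣ p`, Bloch–Kato's
finite part `H¹_f(K_v, V) = Ker (H¹(K_v, V) → H¹(K_v, B_crys ⊗_{ℚ_p} V))` of the local datum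
`D.toLocal v`, relative to crystalline period-ring data `𝔅 v hv` of `K_v = v.adicCompletion K`
(intended: Fontaine's `B_cris`; supplied, as in `GaloisRep.IsGeometric`, as a dependent pair with the
`ℚ_p`-algebra structure of `K_v`, which Mathlib lacks).  This fills the parameter
`BlochKatoDatum.LocalConditionsAbove p` of `blochKatoSelmerGroup`: with it,
`blochKatoSelmerGroup p D (D.crystallineConditionsAbove 𝔅 h)` is Bloch–Kato's `H¹_f(K, W)`.
[cite: BlochKato1990, (3.7.2) and Def. 5.1] -/
def crystallineConditionsAbove (D : BlochKatoDatum K V W)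
    (𝔅 : ∀ v : HeightOneSpectrum (𝓞 K), ((p : ℕ) : 𝓞 K) ∈ v.asIdeal →
      Σ' (_ : Algebra ℚ_[p] (v.adicCompletion K)),
        CrystallinePeriodRingData.{0, u, w} ℚ_[p] (v.adicCompletion K))
    (h : D.repV.IsLinear ℚ_[p]) : D.LocalConditionsAbove p :=
  fun v hv =>
    letI := (𝔅 v hv).1
    (D.toLocal v).crystallineSubgroup (𝔅 v hv).2.toPeriodRingData
      (D.isLinear_restrictField h (v.adicCompletion K))

/-- Unfolding `crystallineConditionsAbove` at a place `v ∣ p`. [folklore] -/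
theorem crystallineConditionsAbove_apply (D : BlochKatoDatum K V W)
    (𝔅 : ∀ v : HeightOneSpectrum (𝓞 K), ((p : ℕ) : 𝓞 K) ∈ v.asIdeal →
      Σ' (_ : Algebra ℚ_[p] (v.adicCompletion K)),
        CrystallinePeriodRingData.{0, u, w} ℚ_[p] (v.adicCompletion K))
    (h : D.repV.IsLinear ℚ_[p]) (v : HeightOneSpectrum (𝓞 K)) (hv : ((p : ℕ) : 𝓞 K) ∈ v.asIdeal) :
    D.crystallineConditionsAbove 𝔅 h v hv =
      letI := (𝔅 v hv).1
      (D.toLocal v).crystallineSubgroup (𝔅 v hv).2.toPeriodRingData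
        (D.isLinear_restrictField h (v.adicCompletion K)) :=
  rfl

/-- **`H¹_f(K_v, W)`, `v ∣ p`**: the crystalline conditions transported to `W` by `π_*`
(`LocalConditionsAbove.ofDatum`), the input of `DiscreteGaloisModule.sigmaSelmerGroup` for Wiles's
`H¹_Σ` with the crystalline condition at `p`. [cite: DiamondFlachGuo2004, §2.1] -/
def crystallineConditionsAboveW (D : BlochKatoDatum K V W)
    (𝔅 : ∀ v : HeightOneSpectrum (𝓞 K), ((p : ℕ) : 𝓞 K) ∈ v.asIdeal →
      Σ' (_ : Algebra ℚ_[p] (v.adicCompletion K)),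
        CrystallinePeriodRingData.{0, u, w} ℚ_[p] (v.adicCompletion K))
    (h : D.repV.IsLinear ℚ_[p]) : D.repW.LocalConditionsAbove p :=
  LocalConditionsAbove.ofDatum p (D.crystallineConditionsAbove 𝔅 h)

/-- At `v ∣ p` the transported condition is `π_* H¹_f(K_v, V) = crystallineImageSubgroup` of the
local datum. [folklore] -/
theorem crystallineConditionsAboveW_apply (D : BlochKatoDatum K V W)
    (𝔅 : ∀ v : HeightOneSpectrum (𝓞 K), ((p : ℕ) : 𝓞 K) ∈ v.asIdeal →
      Σ' (_ : Algebra ℚ_[p] (v.adicCompletion K)),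
        CrystallinePeriodRingData.{0, u, w} ℚ_[p] (v.adicCompletion K))
    (h : D.repV.IsLinear ℚ_[p]) (v : HeightOneSpectrum (𝓞 K)) (hv : ((p : ℕ) : 𝓞 K) ∈ v.asIdeal) :
    D.crystallineConditionsAboveW 𝔅 h v hv =
      letI := (𝔅 v hv).1
      (D.toLocal v).crystallineImageSubgroup (𝔅 v hv).2.toPeriodRingData
        (D.isLinear_restrictField h (v.adicCompletion K)) :=
  rfl

/-- **`H¹_f(K, W) ≤ H¹_Σ(K, W)`** with the crystalline condition at `p`: the Bloch–Kato Selmer group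
built from `crystallineConditionsAbove` injects into every `Σ`-Selmer group built from the
transported conditions `crystallineConditionsAboveW` (Diamond–Flach–Guo's Lemma 2.1, now with the
crystalline condition in place of the parameter). [cite: DiamondFlachGuo2004, Lemma 2.1] -/
theorem blochKatoSelmerGroup_crystalline_le_sigmaSelmerGroup (D : BlochKatoDatum K V W)
    (𝔅 : ∀ v : HeightOneSpectrum (𝓞 K), ((p : ℕ) : 𝓞 K) ∈ v.asIdeal →
      Σ' (_ : Algebra ℚ_[p] (v.adicCompletion K)),
        CrystallinePeriodRingData.{0, u, w} ℚ_[p] (v.adicCompletion K))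
    (h : D.repV.IsLinear ℚ_[p]) (S : Set (HeightOneSpectrum (𝓞 K))) :
    blochKatoSelmerGroup p D (D.crystallineConditionsAbove 𝔅 h) ≤
      D.repW.sigmaSelmerGroup p S (D.crystallineConditionsAboveW 𝔅 h) :=
  blochKatoSelmerGroup_le_sigmaSelmerGroup D _ S

end NumberField

end BlochKatoDatum

end Literature.NumberTheory.GaloisRepresentations
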